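import Summits.ABC.IUTFork.Thm311Real
import Summits.ABC.IUTFork.Thm311Multirad
import Literature.IUT.LogVolume.ArakelovDivisors
import HarnessLib

/-!
# [IUTchIII] Theorem 3.11 over real definitions, B: the data (a)(b)(c) and "the situation of Theorem 3.11 (i)" INSTANTIATED

Record-only file (D-0012) of the abc-iut cell (Cor. 3.12 sub-crew, wave-2 seat abc-iut-c312-5, board row
W2-A); TAKES NO SIDE on [IUTchIII] Cor. 3.12. Sequel to `Thm311Real.lean` (`Real.thetaIndex X`,
`Real.logShells X logv Aut Ism …` from pilot data `X : Literature.IUT.LogVolume.PilotData F`) and companion of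
`Thm311RealM.lean` (the M-level `Real.thetaIndexOfInitial D` / `Real.logShellsOfInitial D …` from L5-t2's
`InitialThetaData`). abc-iut-c312-1's `Thm311Multirad.lean` (p404064) types [IUTchIII] Thm. 3.11 (i) over the
SIGNATURES `MRData L` (data (a)(b)(c) of one vertical line), `GlobalDegrees L j` ((c)'s global realified
Frobenioids) and `Situation T` ("the situation of Theorem 3.11", (i)-part). This file builds them GENERICALLY
from ANY log-shell signature `L : Thm311.LogShells T` (§1–§4) — so that both the Dupuy–Hilado-level carriers of
`Thm311Real` and the M-level carriers of `Thm311RealM` are covered by one construction — and then specialises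
to `Real.logShells` (§5):

* **(a)** the mono-analytic INTEGRAL STRUCTURES at NONARCHIMEDEAN `v_ℚ`, `I(^{S^±_{j+1}};D⊢_{v_ℚ})` and
  `I(^{S^±_{j+1},j};D⊢_v)`, DEFINED as the additive subgroups of the tensor packets generated by the pure
  tensors of shell elements ([IUTchIII] Prop. 3.2 (ii) p. 98: "If `V ∋ v | v_ℚ ∈ V^non_ℚ`, then the
  mono-analytic log-shells … determine [i.e., by forming suitable direct sums and tensor products]
  topological submodules … which may be regarded as integral structures on the `ℚ`-spans" — the
  construction of abc-iut-L6-t4's `shellPacketN` on `MPacketN ℚ`, which the packet IS by `rfl` —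
  abc-iut-c312-7's `Cor312.packet_eq_mpacketN`); at ARCHIMEDEAN `v_ℚ` the print takes "the “closed unit ball” of … the
  induced tensor product Hermitian metric" (p. 99), an object needing a Hermitian structure on the packet
  that no landed decl supplies — BINDERS `archPk`, `archSub`;
* **(c)**'s realified global Frobenioids modelled, as in Dupuy–Hilado §2.5.4 / abc-iut-c312-3's
  `ArakelovDivisors.lean` (p403781), by `ℝ`-divisors on the finite places of a number field `M` (`F` at the DH
  level, `F_mod` at the M level), `F^⊛_MOD ⥲ F^⊛_mod := Equiv.refl`, `deg := FinDivisor.deg M`;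
* `Situation.ofShells L …`, and `Real.situation X …` its DH-level specialisation.

## RESIDUAL LIST of this file (D-0060 ask (3): binder → owner · node · the landed decl it waits for)
* `archPk`, `archSub` — (a)'s integral structures at ARCHIMEDEAN `v_ℚ` (Hermitian unit balls, Prop. 3.2 (ii)
  p. 99) → abc-iut-L6-t4 · IUTchIII:Prop3.2(ii) (`ArchimedeanShellData`, p403825) / abc-iut-L4-t3 ·
  AbsTopIII:Prop5.8(v).
* `Adm`, `logvol` — (a)'s "procession-normalized mono-analytic log-volumes of Proposition 3.9, (ii)" on
  `M(I^ℚ(…))`: abc-iut-L6-t4's `packetLogVolume` / `processionNormalized` (p404053) and abc-iut-S2's `LogVolume`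
  containers live on the direct-sum-of-fields side of the COMPLETED packet ([IUTchIV] Prop. 1.1–1.3 `R_I`,
  abc-iut-S1); the comparison `⨂[ℚ] → completed packet` is the missing piece → abc-iut-S1 · IUTchIV:Prop1.1–1.3
  / abc-iut-c312-6 · W2-C `Cor312Containers` / abc-iut-c312-d1 `HaarTransport` (p405779); abc-iut-L6-t4 ·
  IUTchIII:Prop3.9(ii).
* `Ψ`, `act` — (b)'s splitting monoids and their action → abc-iut-L6-t4 · IUTchIII:Prop3.5(ii)(c)
  (`SplittingMonoids`, p403954) + abc-iut-L6-t2 · IUTchII:Cor4.5/4.6; their VALUES need `q_v ∈ K_v` (Tate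
  uniformisation, infra F1).
* `Mmod` — (c)'s number fields `M^⊛_mod,j` → abc-iut-L6-t4 · IUTchIII:Prop3.3(i)/3.10(i) (`GlobalPacket`).
* `region` — Prop. 3.9 (iii) "the elements of `M(−)` determined by objects `J`" → abc-iut-L6-t4 ·
  IUTchIII:Prop3.9(iii) (`GlobalRegion`) / Ex. 3.6 (ii).
* (from `Thm311Real`) `logv` — abc-iut-S1's `unitLog` (LANDED) once the Mathlib-gap instance
  `NormedAlgebra ℚ_[p_v] (v.adicCompletion F)` exists (WAVE2-SLICES row 42).

## Vacuity audit (LANA Rem. 8.2.1 discipline; neutral; kernel-checked for EVERY `L`)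
`Situation.multiradialCompat_of_const`: if the line data (b)(c) do not depend on the vertical coordinate
`n`, abc-iut-c312-1's `Situation.MultiradialCompat` holds by `rfl`; `Situation.not_multiradialCompat_example`:
line data that DO depend on `n` (splitting-monoid slot empty on line `0`, everything elsewhere) violate it.
So the clause is a genuine constraint on `Ψ`/`Mmod`, not on the carriers (cf. c312-1's `partIIIa_holds` and
`Thm311Checks`). `Situation.degreeClause_ofShells_iff`: the degree clause constrains `logvol`/`region` against
the FIXED Arakelov degree — not automatic either.

Sources read on the page: [IUTchIII] pp. 98–99 (Prop. 3.2 (ii)), 153–155 (Thm. 3.11 (i) (a)(b)(c));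
Dupuy–Hilado arXiv:2004.13228 §2.5.4, §3.3. [claim: Mochizuki2012, status: disputed] [cite: DupuyHilado2025, §2.5.4]
NOT here: `Column` / `LatticeSituation` (sequel C), `PilotNouns` / `LinkData` (W2-B/W2-C objects; (iii) is
tautological per c312-1); any log-volume value; any judgement. typed ≠ discharged; instantiated ≠ endorsed.
-/

noncomputable section

namespace Summit.ABC.IUTFork.Thm311

open NumberField IsDedekindDomain Literature.IUT.LogVolume Literature.IUT.LogThetaLattice

variable {T : ThetaIndex}

namespace LogShells

variable (L : LogShells T)

/-! ## 1. Integral structures of the tensor packets, for ANY log-shell signature -/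

/- DICTIONARY: `L.Packet j vQ = Literature.IUT.LogThetaLattice.MPacketN ℚ (fun _ v => L.carrier v.1)` holds by
`rfl` for every `L` — recorded (and kernel-checked) in abc-iut-c312-7's `Cor312.packet_eq_mpacketN`
(`Cor312Statement.lean`, landed) and abc-iut-c312-1's `Thm311Dictionary`; not repeated here to keep this file's
imports free of `TensorPackets` (olean incoherent at filing time). -/

/-- The log-shell `I_v ⊆ log(D⊢_v)` as an ADDITIVE SUBGROUP (the subgroup it generates; at a finite `v` of a
real instance `I_v = (p_v^*)⁻¹·log_v(O_v^×)` already is one). Used ONLY at nonarchimedean places below.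
[claim: Mochizuki2012, status: disputed] -/
def shellSubgroup (v : T.V) : AddSubgroup (L.carrier v) := AddSubgroup.closure (L.shell v)

/-- The shell lies in the subgroup it generates. [folklore] -/
theorem shell_subset_shellSubgroup (v : T.V) : L.shell v ⊆ L.shellSubgroup v := AddSubgroup.subset_closure

/-- **(a), first integral structure, NONARCHIMEDEAN clause** ([IUTchIII] Prop. 3.2 (ii) p. 98):
`I(^{S^±_{j+1}};D⊢_{v_ℚ}) ⊆ I^ℚ(…)`, the additive subgroup of `⨂_{i ≤ j} ⊕_{v|v_ℚ} log(D⊢_v)` generated by the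
pure tensors `x_0 ⊗ ⋯ ⊗ x_j` with every `x_{i,v} ∈ I_v` ("by forming suitable direct sums and tensor products";
abc-iut-L6-t4's `shellPacketN`). Makes sense at every `v_ℚ`; models the print at nonarchimedean ones.
[claim: Mochizuki2012, status: disputed] -/
def shellPk (j : T.Label) (vQ : T.VQ) : AddSubgroup (L.Packet j vQ) :=
  AddSubgroup.closure
    {t | ∃ x : T.Caps j → L.Packet1 vQ, (∀ i (v : T.Fibre vQ), x i v ∈ L.shellSubgroup v.1) ∧ t = L.tprod j vQ x}

/-- **(a), second integral structure, NONARCHIMEDEAN clause**: `I(^{S^±_{j+1},j};D⊢_v) ⊆ I^ℚ(^{S^±_{j+1},j};D⊢_v)`,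
generated by the pure tensors of shell elements whose `j`-th component is supported on the summand `v`
([IUTchIII] Prop. 3.2 (ii) "`I(^{A,α}D⊢_v) ⊆ log(^{A,α}D⊢_v)`" with Prop. 3.1 (ii); abc-iut-L6-t4's `shellPacketAt`).
[claim: Mochizuki2012, status: disputed] -/
def shellSub (j : T.Label) (v : T.V) : AddSubgroup (L.Packet j (T.over v)) :=
  AddSubgroup.closure
    {t | ∃ x : T.Caps j → L.Packet1 (T.over v), (∀ i (w : T.Fibre (T.over v)), x i w ∈ L.shellSubgroup w.1) ∧
      (∀ w : T.Fibre (T.over v), w.1 ≠ v → x (T.selfIndex j) w = 0) ∧ t = L.tprod j _ x}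

/-- The second integral structure lies in abc-iut-c312-1's sub-packet `log(^{S^±_{j+1},j}D⊢_v)`. [folklore] -/
theorem shellSub_le_subPacket (j : T.Label) (v : T.V) : L.shellSub j v ≤ (L.SubPacket j v).toAddSubgroup := by
  refine (AddSubgroup.closure_le _).mpr ?_
  rintro _ ⟨x, _, hx0, rfl⟩
  exact Submodule.subset_span ⟨x, hx0, rfl⟩

end LogShells

/-! ## 2. The data (a), (b), (c) of one vertical line, from any log-shell signature -/

namespace MRData

open scoped Classical in
/-- **`Thm311.MRData` BUILT FROM A LOG-SHELL SIGNATURE** ([IUTchIII] Thm. 3.11 (i) (a)(b)(c), pp. 153–154):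
(a) the integral structures at NONARCHIMEDEAN `v_ℚ` DEFINED from the shells (`LogShells.shellPk/shellSub`;
Prop. 3.2 (ii) first clause), at ARCHIMEDEAN `v_ℚ` (Hermitian unit balls, p. 99) the BINDERS `archPk`,
`archSub`; the admissible regions `M(−)` and the procession-normalized mono-analytic log-volume as the BINDERS
`Adm`, `logvol`; (b) the splitting monoids at `v ∈ V^bad` and their action as the BINDERS `Ψ`, `act`; (c)
the number fields `M^⊛_mod,j` as the BINDER `Mmod` (owners: module docstring). [claim: Mochizuki2012, status: disputed] -/
def ofShells (L : LogShells T)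
    (archPk : ∀ (j : T.Label) (vQ : T.VQ), Set (L.Packet j vQ))
    (archSub : ∀ (j : T.Label) (v : T.V), Set (L.Packet j (T.over v)))
    (Adm : ∀ (j : T.Label) (vQ : T.VQ), Set (L.Packet j vQ) → Prop)
    (logvol : ∀ (j : T.Label) (vQ : T.VQ), Set (L.Packet j vQ) → ℝ)
    (Ψ : ∀ v : T.V, v ∈ T.Vbad → Set (L.StarPacket v))
    (act : ∀ v : T.V, v ∈ T.Vbad → L.StarPacket v → Module.End ℚ (L.StarPacket v))
    (Mmod : ∀ j : T.LabelStar, Set (L.GlobalPacket j.1)) : MRData L where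
  shellPk j vQ := if T.IsNon vQ then (L.shellPk j vQ : Set _) else archPk j vQ
  shellSub j v := if T.IsNon (T.over v) then (L.shellSub j v : Set _) else archSub j v
  Adm := Adm
  logvol := logvol
  Ψ := Ψ
  act := act
  Mmod := Mmod

variable (L : LogShells T)
  (archPk : ∀ (j : T.Label) (vQ : T.VQ), Set (L.Packet j vQ))
  (archSub : ∀ (j : T.Label) (v : T.V), Set (L.Packet j (T.over v)))
  (Adm : ∀ (j : T.Label) (vQ : T.VQ), Set (L.Packet j vQ) → Prop)
  (logvol : ∀ (j : T.Label) (vQ : T.VQ), Set (L.Packet j vQ) → ℝ)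
  (Ψ : ∀ v : T.V, v ∈ T.Vbad → Set (L.StarPacket v))
  (act : ∀ v : T.V, v ∈ T.Vbad → L.StarPacket v → Module.End ℚ (L.StarPacket v))
  (Mmod : ∀ j : T.LabelStar, Set (L.GlobalPacket j.1))

/-- At a nonarchimedean `v_ℚ` the (a) integral structure is the DEFINED one. [folklore] -/
theorem ofShells_shellPk_of_isNon {j : T.Label} {vQ : T.VQ} (h : T.IsNon vQ) :
    (ofShells L archPk archSub Adm logvol Ψ act Mmod).shellPk j vQ = (L.shellPk j vQ : Set _) := by
  classical
  exact if_pos h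

/-- At an archimedean `v_ℚ` the (a) integral structure is the binder. [folklore] -/
theorem ofShells_shellPk_of_not_isNon {j : T.Label} {vQ : T.VQ} (h : ¬ T.IsNon vQ) :
    (ofShells L archPk archSub Adm logvol Ψ act Mmod).shellPk j vQ = archPk j vQ := by
  classical
  exact if_neg h

/-- `0` lies in every nonarchimedean integral structure (a subgroup) — weak non-vacuity of (a). [folklore] -/
theorem zero_mem_ofShells_shellPk {j : T.Label} {vQ : T.VQ} (h : T.IsNon vQ) :
    (0 : L.Packet j vQ) ∈ (ofShells L archPk archSub Adm logvol Ψ act Mmod).shellPk j vQ := by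
  rw [ofShells_shellPk_of_isNon L archPk archSub Adm logvol Ψ act Mmod h]
  exact (L.shellPk j vQ).zero_mem

/-- The splitting-monoid slot being EMPTY is invariant under the (Ind1)/(Ind2) moves (transport = image under a
linear automorphism). [folklore] -/
theorem psi_eq_empty_invariant {L : LogShells T} (v : T.V) (hv : v ∈ T.Vbad) (D D' : MRData L)
    (h : IndMoves D D') : D.Ψ v hv = ∅ ↔ D'.Ψ v hv = ∅ := by
  obtain ⟨Φ, _, rfl⟩ := h
  show D.Ψ v hv = ∅ ↔ L.starAut Φ v '' D.Ψ v hv = ∅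
  rw [Set.image_eq_empty]

end MRData

/-! ## 3. (c)'s global realified Frobenioids by Arakelov divisors on the finite places -/

namespace GlobalDegrees

/-- **`Thm311.GlobalDegrees` BUILT FROM ARAKELOV DIVISORS** at label `j ∈ F_l^⋇` ([IUTchIII] Thm. 3.11 (i) (c);
Ex. 3.6 (ii): objects = collections `{J_v}` of local fractional ideals of a number field `M` — `F` at the DH
level, `F_mod` at the M level): objects modelled, as in Dupuy–Hilado §2.5.4 / abc-iut-c312-3's
`ArakelovDivisors.lean`, by `ℝ`-divisors on the finite places `FinDivisor M` (archimedean components and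
linear equivalence elided), `F^⊛_MOD,j ⥲ F^⊛_mod,j := Equiv.refl` (one carrier), `deg := FinDivisor.deg M`, and
the region of `∏_{v_ℚ} I^ℚ(…)` determined by `J` as the BINDER `region` (Prop. 3.9 (iii)).
[claim: Mochizuki2012, status: disputed] -/
def ofDivisors (L : LogShells T) (M : Type) [Field M] [NumberField M] (j : T.LabelStar)
    (region : FinDivisor M → ∀ vQ : T.VQ, Set (L.Packet j.1 vQ)) : GlobalDegrees L j where
  ObjMOD := FinDivisor M
  Objmod := FinDivisor M
  natIso := Equiv.refl _
  deg := FinDivisor.deg M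
  region := region

end GlobalDegrees

/-! ## 4. "The situation of Theorem 3.11", (i)-part, from any log-shell signature -/

namespace Situation

section OfShells

variable (L : LogShells T) (M : Type) [Field M] [NumberField M]
  (archPk : ∀ (j : T.Label) (vQ : T.VQ), Set (L.Packet j vQ))
  (archSub : ∀ (j : T.Label) (v : T.V), Set (L.Packet j (T.over v)))
  (Adm : ∀ (j : T.Label) (vQ : T.VQ), Set (L.Packet j vQ) → Prop)
  (logvol : ∀ (j : T.Label) (vQ : T.VQ), Set (L.Packet j vQ) → ℝ)
  (Ψ : ℤ → ∀ v : T.V, v ∈ T.Vbad → Set (L.StarPacket v))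
  (act : ℤ → ∀ v : T.V, v ∈ T.Vbad → L.StarPacket v → Module.End ℚ (L.StarPacket v))
  (Mmod : ℤ → ∀ j : T.LabelStar, Set (L.GlobalPacket j.1))
  (region : ℤ → ∀ j : T.LabelStar, FinDivisor M → ∀ vQ : T.VQ, Set (L.Packet j.1 vQ))

/-- **`Thm311.Situation` BUILT FROM A LOG-SHELL SIGNATURE** ([IUTchIII] Thm. 3.11, p. 153 "the situation of
Theorem 3.11", (i)-part): the bi-coric log-shells `L`, for every vertical line `n ∈ ℤ` the data (a)(b)(c)
`MRData.ofShells` (coric parts shared; the line's own `Ψ n`, `act n`, `Mmod n`), and the global Frobenioids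
`GlobalDegrees.ofDivisors` over the number field `M` with the line's `region n`.
[claim: Mochizuki2012, status: disputed] -/
def ofShells : Situation T where
  L := L
  D n := MRData.ofShells L archPk archSub Adm logvol (Ψ n) (act n) (Mmod n)
  G n j := GlobalDegrees.ofDivisors L M j (region n j)

/-- The log-shells of the built situation are `L`. [folklore] -/
theorem ofShells_L : (ofShells L M archPk archSub Adm logvol Ψ act Mmod region).L = L := rfl

/-- The line-`n` data of the built situation. [folklore] -/
theorem ofShells_D (n : ℤ) :
    (ofShells L M archPk archSub Adm logvol Ψ act Mmod region).D n =
      MRData.ofShells L archPk archSub Adm logvol (Ψ n) (act n) (Mmod n) := rfl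

/-- **VACUITY AUDIT (neutral), for every `L`.** If the line data (b)(c) do not depend on `n`, abc-iut-c312-1's
typing of the concluding assertion of [IUTchIII] Thm. 3.11 (i) (`MultiradialCompat`: `^{n,∘}R^{LGP} = ^{n',∘}R^{LGP}`)
holds BY `rfl`; at this level of modelling the content of (i) is carried by how the data of different lines
are identified (the `Θ×μ_LGP`-link) and by `MRData.LogvolInvariant` (cf. c312-1's `partIIIa_holds`, LANA
Rem. 8.2.1). [folklore] -/
theorem multiradialCompat_of_const (Ψ₀ : ∀ v : T.V, v ∈ T.Vbad → Set (L.StarPacket v))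
    (act₀ : ∀ v : T.V, v ∈ T.Vbad → L.StarPacket v → Module.End ℚ (L.StarPacket v))
    (Mmod₀ : ∀ j : T.LabelStar, Set (L.GlobalPacket j.1)) :
    (ofShells L M archPk archSub Adm logvol (fun _ => Ψ₀) (fun _ => act₀) (fun _ => Mmod₀) region).MultiradialCompat :=
  fun _ _ => rfl

/-- **NON-VACUITY, for every `L`.** Line data that DEPEND on `n` — the splitting-monoid slot (b) empty on line `0`
and all of `∏_j I^ℚ(…)` on the other lines — violate `MultiradialCompat`: no chain of (Ind1)/(Ind2) moves relates
data with empty and with nonempty splitting monoid. So the clause is refutable as well as satisfiable over ANY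
carriers: its truth is a property of the binders `Ψ`, `Mmod`. [folklore] -/
theorem not_multiradialCompat_example
    (act₀ : ∀ v : T.V, v ∈ T.Vbad → L.StarPacket v → Module.End ℚ (L.StarPacket v))
    (Mmod₀ : ∀ j : T.LabelStar, Set (L.GlobalPacket j.1)) :
    ¬ (ofShells L M archPk archSub Adm logvol
        (fun n v _ => if n = 0 then (∅ : Set (L.StarPacket v)) else Set.univ)
        (fun _ => act₀) (fun _ => Mmod₀) region).MultiradialCompat := by
  intro h
  obtain ⟨v, hv⟩ := T.Vbad_nonempty
  have hmem := Situation.mem_RLGP_of_multiradialCompat _ h 0 1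
  have key := MRData.wellDefined_on_RLGP (P := fun D => D.Ψ v hv = ∅)
    (fun D D' hDD' => MRData.psi_eq_empty_invariant v hv D D' hDD') hmem
  have h0 : ((ofShells L M archPk archSub Adm logvol
      (fun n v _ => if n = 0 then (∅ : Set (L.StarPacket v)) else Set.univ)
      (fun _ => act₀) (fun _ => Mmod₀) region).D 0).Ψ v hv = ∅ := by
    show (if (0 : ℤ) = 0 then (∅ : Set (L.StarPacket v)) else Set.univ) = ∅
    rw [if_pos rfl]
  have h1 : (Set.univ : Set (L.StarPacket v)) = ∅ := by
    have h1' := key.mp h0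
    have e : ((ofShells L M archPk archSub Adm logvol
        (fun n v _ => if n = 0 then (∅ : Set (L.StarPacket v)) else Set.univ)
        (fun _ => act₀) (fun _ => Mmod₀) region).D 1).Ψ v hv = Set.univ := by
      show (if (1 : ℤ) = 0 then (∅ : Set (L.StarPacket v)) else Set.univ) = Set.univ
      rw [if_neg one_ne_zero]
    rw [e] at h1'
    exact h1'
  exact Set.univ_nonempty.ne_empty h1

/-- The degree clause of (c) for the built situation is a genuine constraint relating `logvol` and `region`
to the FIXED Arakelov degree `FinDivisor.deg M` — recorded as its unfolding. [folklore] -/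
theorem degreeClause_ofShells_iff :
    (ofShells L M archPk archSub Adm logvol Ψ act Mmod region).DegreeClause ↔
      ∀ n : ℤ, DegreesViaLogvol (MRData.ofShells L archPk archSub Adm logvol (Ψ n) (act n) (Mmod n))
        (fun j => GlobalDegrees.ofDivisors L M j (region n j)) :=
  Iff.rfl

end OfShells

end Situation

/-! ## 5. Specialisation to the Dupuy–Hilado-level real carriers of `Thm311Real` -/

namespace Real

variable {F : Type} [Field F] [NumberField F]
variable (X : PilotData F) (logv : PadicLogs F) (Aut Ism : ∀ x : Place F, Set (Carrier x ≃ₗ[ℚ] Carrier x))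
  (hAut : ∀ x, LinearEquiv.refl ℚ (Carrier x) ∈ Aut x) (hIsm : ∀ x, LinearEquiv.refl ℚ (Carrier x) ∈ Ism x)
  (archPk : ∀ (j : (thetaIndex X).Label) (vQ : RatPlace), Set ((logShells X logv Aut Ism hAut hIsm).Packet j vQ))
  (archSub : ∀ (j : (thetaIndex X).Label) (v : Place F),
    Set ((logShells X logv Aut Ism hAut hIsm).Packet j ((thetaIndex X).over v)))
  (Adm : ∀ (j : (thetaIndex X).Label) (vQ : RatPlace), Set ((logShells X logv Aut Ism hAut hIsm).Packet j vQ) → Prop)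
  (logvol : ∀ (j : (thetaIndex X).Label) (vQ : RatPlace), Set ((logShells X logv Aut Ism hAut hIsm).Packet j vQ) → ℝ)
  (Ψ : ℤ → ∀ v : Place F, v ∈ (thetaIndex X).Vbad → Set ((logShells X logv Aut Ism hAut hIsm).StarPacket v))
  (act : ℤ → ∀ v : Place F, v ∈ (thetaIndex X).Vbad → (logShells X logv Aut Ism hAut hIsm).StarPacket v →
    Module.End ℚ ((logShells X logv Aut Ism hAut hIsm).StarPacket v))
  (Mmod : ℤ → ∀ j : (thetaIndex X).LabelStar, Set ((logShells X logv Aut Ism hAut hIsm).GlobalPacket j.1))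
  (region : ℤ → ∀ j : (thetaIndex X).LabelStar,
    FinDivisor F → ∀ vQ : RatPlace, Set ((logShells X logv Aut Ism hAut hIsm).Packet j.1 vQ))

/-- **"The situation of Theorem 3.11" ((i)-part) over the REAL carriers of `Thm311Real`**: index skeleton from
pilot data, carriers `K_v`, log-shells from abc-iut-L6-t3, nonarchimedean integral structures DEFINED, global
Frobenioids by Arakelov divisors of `F`, the rest binders (module docstring). [claim: Mochizuki2012, status: disputed] -/
abbrev situation : Situation (thetaIndex X) :=
  Situation.ofShells (logShells X logv Aut Ism hAut hIsm) F archPk archSub Adm logvol Ψ act Mmod region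

/-- At a prime `p` the instantiated (a) integral structure is the DEFINED lattice of pure tensors of shell
elements (the prime being nonarchimedean). [folklore] -/
theorem situation_shellPk_inr (n : ℤ) (j : (thetaIndex X).Label) (p : Nat.Primes) :
    ((situation X logv Aut Ism hAut hIsm archPk archSub Adm logvol Ψ act Mmod region).D n).shellPk j (.inr p) =
      ((logShells X logv Aut Ism hAut hIsm).shellPk j (.inr p) :
        Set ((logShells X logv Aut Ism hAut hIsm).Packet j (.inr p))) :=
  MRData.ofShells_shellPk_of_isNon _ _ _ _ _ _ _ _ (RatPlace.isNon_inr p)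

/-- The instantiated degree of the `q`-pilot divisor is POSITIVE (abc-iut-c312-3's `PilotData.deg_qPilot_pos`) —
the instance's form of "`|log(q)| > 0` … computed in terms of the various `q`-parameters … at `v ∈ V^bad (≠ ∅)`"
([IUTchIII] Cor. 3.12). [cite: DupuyHilado2025, §3.3] -/
theorem situation_deg_qPilot_pos (n : ℤ) (j : (thetaIndex X).LabelStar) :
    0 < ((situation X logv Aut Ism hAut hIsm archPk archSub Adm logvol Ψ act Mmod region).G n j).deg X.qPilot :=
  X.deg_qPilot_pos

end Real

end Summit.ABC.IUTFork.Thm311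

end
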